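import Mathlib
import Literature.AlgebraicGeometry.Resolution.ProperModelsPatching
import Literature.AlgebraicGeometry.Resolution.ProperModelsRegLeification

/-!
# Crux `PatchingRel` (stmt-ResolutionOfSingularities-0642), line `sandwiched-gluing`,
# stub `stub_regLeification_of_local`

Compactifying the local RegLe-ification of a morphism of PROPER models of a function field:
the extension property of proper birational modifications over opens of proper models (the
"ProperExtension" hypothesis, supplied on the line by a Nagata compactification) together with
`ProperModel.LocalRegLeification.{0} p` (`ProperModelsPatching.lean`) gives
`ProperModel.RegLeification.{0} p`. This is the universe-`0` instance of the tree theorem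
`Literature.AlgebraicGeometry.Resolution.ProperModel.regLeification_of_local`
(`ProperModelsRegLeification.lean`): bookkeeping through the cartesian square `P' ×_M O = N`
(points of `P'` over `O` lift to `N`, stalks along the open immersion `N → P'` are isomorphic).
-/

noncomputable section

open CategoryTheory AlgebraicGeometry
open Literature.AlgebraicGeometry.Resolution

-- `Summit.<Summit>.<Sub>.Theorems` with `Sub = Summit` (single-conjunct summit, D-0017): the duplicated
-- namespace component is the tree layout.
set_option linter.dupNamespace false

namespace Summit.ResolutionOfSingularities.ResolutionOfSingularities.Theorems

/-- **Stub `stub_regLeification_of_local` of line `sandwiched-gluing`** (crux `PatchingRel`,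
stmt-ResolutionOfSingularities-0642): if every proper birational integral `g : Y → U` over an
open `U` of a proper model `P` of `K/k` extends to a morphism of proper models `φ : P' → P` with
an open immersion `i : Y → P'.X` and `Y = P' ×_P U` (`IsPullback i g φ.f U.ι`), then a local
RegLe-ification of every morphism of proper models in characteristic `p`
(`ProperModel.LocalRegLeification.{0} p`) yields a RegLe-ification
(`ProperModel.RegLeification.{0} p`): feed `(M, O, N, ρ)` to the extension, lift points of `P'`
over `O` to `N` through the cartesian square and transport regularity of stalks along the open
immersion (`ProperModel.regLeification_of_local`). [cite: Piltant2013, proof of Prop. 5.1, Step 5] -/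
theorem stub_regLeification_of_local : ∀ p : ℕ,
    (∀ (k : Type) [Field k] (K : Type) [Field K] [Algebra k K] (P : ProperModel k K)
      (U : P.X.Opens) (Y : Scheme.{0}) [IsIntegral Y] (g : Y ⟶ (U : Scheme.{0})) [IsProper g],
      IsBirational g →
        ∃ (P' : ProperModel k K) (φ : P'.Hom P) (i : Y ⟶ P'.X), IsOpenImmersion i ∧
          IsPullback i g φ.f U.ι) →
    ProperModel.LocalRegLeification.{0} p → ProperModel.RegLeification.{0} p :=
  fun p hext hloc => ProperModel.regLeification_of_local p hext hloc

end Summit.ResolutionOfSingularities.ResolutionOfSingularities.Theorems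

end
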